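import Mathlib

/-!
# Crux `PicoverLocalModel` (stmt-ResolutionOfSingularities-0557), line `SketchIdeator3`
# (giraud-cossart-normal-form) — local half of the endgame: the wound/transversal twist

Helpers for the ENDGAME stub `stub_logRegularEndgame` of the line (a `p`-cyclic cover
`t^p = a` in Kummer normal form along an snc boundary of a regular scheme is resolved by its
normalisation plus one log blow-up; `Literature.AlgebraicGeometry.Resolution.KummerNormalFormAt`).
At a point where the radicand is in the FIRST alternative of the Kummer normal form,
`a = g^p + x_B^p · u` (`x_B = ∏ x_j^{B_j}` a monomial in the boundary equations, `D u` a unit for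
a logarithmic derivation `D`), the normalisation of the local model `M = O[t]/(t^p - a)` is the
WOUND TWIST `M' = O[s]/(s^p - u)`, `s ↦ t' = (t - g)/x_B`, which is regular by Stacks 07PG (in
tree: `Literature.AlgebraicGeometry.Resolution.isRegularRing_adjoinRoot_X_pow_sub_C_of_derivation`
with `isRegularRing_of_isRegularLocalRing`). This file PROVES the algebra behind "`M'` is an
order of `Frac M` containing `M`" (so it IS the normalisation as soon as it is normal), for an
arbitrary commutative ring `O` of characteristic `p`:

* `exists_algHom_adjoinRoot_to_wound_twist` — the finite cover `Spec M' → Spec M`: the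
  `O`-algebra map `θ : M → M'`, `t ↦ g + x_B s` (`(g + x_B s)^p = g^p + x_B^p u = a`);
* `exists_algHom_adjoinRoot_wound_twist_of_isUnit` — over any `O`-algebra `L` in which `x_B`
  is a unit and `a` has a `p`-th root `t`, the `O`-algebra map `φ : M' → L`, `s ↦ (t - g)/x_B`
  (`((t - g)/x_B)^p = (t^p - g^p)/x_B^p = u`);
* `injective_algHom_adjoinRoot_wound_twist` (mechanism: `injective_algHom_adjoinRoot_of_monic`)
  — any such `φ` is injective as soon as `M → L` is: a relation `Q(φ s) = 0`, `deg Q < p`,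
  rescales (`Polynomial.scaleRoots` by `x_B`, then the shift `X ↦ X - g`) to a polynomial of
  degree `< p` vanishing at `t` in `M = O[X]/(X^p - a)`, hence divisible by `X^p - a`, hence
  zero;
* `algHom_comp_wound_twist` — `φ ∘ θ` is the structure map `M → L` (the image of `φ` contains
  the image of `M`);
* `exists_algHom_adjoinRoot_wound_twist` — in particular, for `O` a domain, `x_B ≠ 0` and `M`
  a domain: an injective `O`-algebra map `M' → Frac M`, `x_B s ↦ t - g` (birationality of the
  twist: `M ⊆ O[t'] ≅ M'` inside `Frac M`).
-/

open Polynomial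

-- `Summit.<Summit>.<Sub>.Theorems.…` with `Sub = Summit` (single-conjunct summit, D-0017).
set_option linter.dupNamespace false

namespace Summit.ResolutionOfSingularities.ResolutionOfSingularities.Theorems.PicoverLocalModel.LogRegularEndgame

/-- **The wound twist covers the model.** For `a = g^p + x_B^p · u` in a ring `O` of
characteristic `p`, the `O`-algebra map `O[t]/(t^p - a) → O[s]/(s^p - u)`, `t ↦ g + x_B · s`
(well defined as `(g + x_B s)^p = g^p + x_B^p s^p = a`). [folklore] -/
theorem exists_algHom_adjoinRoot_to_wound_twist : ∀ {O : Type*} [CommRing O] (p : ℕ) [Fact p.Prime] [CharP O p] (a g u xB : O), a = g ^ p + xB ^ p * u → ∃ θ : AdjoinRoot ((Polynomial.X : Polynomial O) ^ p - Polynomial.C a) →ₐ[O] AdjoinRoot ((Polynomial.X : Polynomial O) ^ p - Polynomial.C u), θ (AdjoinRoot.root _) = algebraMap O _ g + algebraMap O _ xB * AdjoinRoot.root ((Polynomial.X : Polynomial O) ^ p - Polynomial.C u) := by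
  intro O _ p _ _ a g u xB ha
  set f' : O[X] := (X : O[X]) ^ p - C u with hf'
  set s : AdjoinRoot f' := AdjoinRoot.root f' with hs_def
  have hs : s ^ p = algebraMap O (AdjoinRoot f') u := by
    have h0 : aeval s f' = 0 := by rw [hs_def]; exact AdjoinRoot.aeval_eq f' ▸ AdjoinRoot.mk_self
    simp only [hf', map_sub, map_pow, aeval_X, aeval_C] at h0
    exact sub_eq_zero.mp h0
  -- the polynomial identity `(g + x_B X)^p = a + x_B^p (X^p - u)` over `O` (characteristic `p`)
  have hX : (C g + C xB * (X : O[X])) ^ p = C a + C (xB ^ p) * (X ^ p - C u) := by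
    rw [add_pow_char, mul_pow, ← C_pow, ← C_pow, ha]
    simp only [C_add, C_mul, C_pow]
    ring
  set r : AdjoinRoot f' := algebraMap O (AdjoinRoot f') g + algebraMap O (AdjoinRoot f') xB * s
    with hr
  have hrp : r ^ p = algebraMap O (AdjoinRoot f') a := by
    have h := congrArg (aeval s) hX
    simp only [map_pow, map_add, map_mul, map_sub, aeval_C, aeval_X, hs, sub_self, mul_zero,
      add_zero] at h
    rw [hr]
    exact h
  have hroot : ((X : O[X]) ^ p - C a).eval₂ (↑(Algebra.ofId O (AdjoinRoot f'))) r = 0 := by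
    change aeval r ((X : O[X]) ^ p - C a) = 0
    simp only [map_sub, map_pow, aeval_X, aeval_C, hrp, sub_self]
  refine ⟨AdjoinRoot.liftAlgHom _ (Algebra.ofId O _) r hroot, ?_⟩
  rw [AdjoinRoot.liftAlgHom_root]

/-- **The wound twist, abstract target.** For `a = g^p + x_B^p · u` in a ring `O` of
characteristic `p` and an `O`-algebra `L` in which `x_B` becomes a unit and `a` acquires a
`p`-th root `t`, there is an `O`-algebra map `O[s]/(s^p - u) → L` taking `s` to
`s' = (t - g)/x_B`, i.e. `x_B · s' = t - g` (well defined: `x_B^p s'^p = (t - g)^p = t^p - g^p =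
a - g^p = x_B^p u`, and `x_B^p` is a unit). [folklore] -/
theorem exists_algHom_adjoinRoot_wound_twist_of_isUnit : ∀ {O L : Type*} [CommRing O] [CommRing L] [Algebra O L] (p : ℕ) [Fact p.Prime] [CharP O p] (a g u xB : O) (t : L), a = g ^ p + xB ^ p * u → IsUnit (algebraMap O L xB) → t ^ p = algebraMap O L a → ∃ φ : AdjoinRoot ((Polynomial.X : Polynomial O) ^ p - Polynomial.C u) →ₐ[O] L, algebraMap O L xB * φ (AdjoinRoot.root _) = t - algebraMap O L g := by
  intro O L _ _ _ p _ _ a g u xB t ha hxB ht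
  obtain ⟨v, hv⟩ := hxB
  -- the polynomial identity `(X - g)^p = (X^p - a) + x_B^p u` over `O` (characteristic `p`)
  have hX : ((X : O[X]) - C g) ^ p = (X ^ p - C a) + C (xB ^ p * u) := by
    rw [sub_pow_char, ← C_pow, ha]
    simp only [C_add, C_mul, C_pow]
    ring
  -- evaluated at `t`
  have hkey : (t - algebraMap O L g) ^ p = algebraMap O L xB ^ p * algebraMap O L u := by
    have h := congrArg (aeval t) hX
    simp only [map_pow, map_sub, map_add, map_mul, aeval_X, aeval_C, ht, sub_self, zero_add] at h
    exact h
  set s : L := ((v⁻¹ : Lˣ) : L) * (t - algebraMap O L g) with hs_def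
  have hxs : algebraMap O L xB * s = t - algebraMap O L g := by
    rw [hs_def, ← mul_assoc, ← hv, Units.mul_inv, one_mul]
  have hs : s ^ p = algebraMap O L u := by
    have h1 : (v : L) ^ p * s ^ p = (v : L) ^ p * algebraMap O L u := by
      rw [← mul_pow, hv, hxs, hkey]
    exact ((Units.isUnit v).pow p).mul_left_cancel h1
  have hroot : ((X : O[X]) ^ p - C u).eval₂ (↑(Algebra.ofId O L)) s = 0 := by
    change aeval s ((X : O[X]) ^ p - C u) = 0
    simp only [map_sub, map_pow, aeval_X, aeval_C, hs, sub_self]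
  refine ⟨AdjoinRoot.liftAlgHom _ (Algebra.ofId O L) s hroot, ?_⟩
  rw [AdjoinRoot.liftAlgHom_root]
  exact hxs

/-- The polynomial mechanism behind `injective_algHom_adjoinRoot_wound_twist`, for arbitrary
monic `f`, `f'` with `deg f' ≤ deg f` over a nontrivial ring `O`: if `O[X]/(f)` maps injectively
to `L` and `φ : O[X]/(f') → L` satisfies `x_B · φ(s) = t - g` (`s`, `t` the classes of `X`), then
`φ` is injective — a relation `Q(φ s) = 0`, `deg Q < deg f'`, gives
`(scaleRoots Q x_B)(X - g)`, of degree `< deg f`, vanishing at `t`, hence divisible by `f`, hence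
zero, whence `Q = 0`. [folklore] -/
theorem injective_algHom_adjoinRoot_of_monic {O L : Type*} [CommRing O] [Nontrivial O]
    [CommRing L] [Algebra O L] {f f' : O[X]} (hfm : f.Monic) (hf'm : f'.Monic)
    (hdeg : f'.natDegree ≤ f.natDegree) [Algebra (AdjoinRoot f) L]
    [IsScalarTower O (AdjoinRoot f) L]
    (hinj : Function.Injective (algebraMap (AdjoinRoot f) L)) (φ : AdjoinRoot f' →ₐ[O] L)
    (xB g : O) (hφ : algebraMap O L xB * φ (AdjoinRoot.root f') =
      algebraMap (AdjoinRoot f) L (AdjoinRoot.root f) - algebraMap O L g) :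
    Function.Injective φ := by
  rw [injective_iff_map_eq_zero]
  intro y hy
  -- write `y = Q mod f'` with `deg Q < deg f'`
  obtain ⟨q, rfl⟩ := AdjoinRoot.mk_surjective y
  set Q : O[X] := q %ₘ f' with hQ
  have hyQ : AdjoinRoot.mk f' Q = AdjoinRoot.mk f' q := by
    have h := AdjoinRoot.mk_leftInverse hf'm (AdjoinRoot.mk f' q)
    rwa [AdjoinRoot.modByMonicHom_mk] at h
  by_cases hQ0 : Q = 0
  · rw [← hyQ, hQ0, map_zero]
  exfalso
  have hQnat : Q.natDegree < f'.natDegree :=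
    natDegree_lt_natDegree hQ0 (degree_modByMonic_lt q hf'm)
  -- `Q` kills `σ = φ(s)`, where `x_B σ = t - g`
  have hσQ : aeval (φ (AdjoinRoot.root f')) Q = 0 := by
    rw [← hyQ, ← AdjoinRoot.aeval_eq, ← aeval_algHom_apply] at hy
    exact hy
  -- rescale by `x_B` and shift by `g`: a polynomial of degree `< deg f` killing `t`
  set Q₁ : O[X] := (scaleRoots Q xB).comp (X - C g) with hQ₁
  have hQ₁t : aeval (algebraMap (AdjoinRoot f) L (AdjoinRoot.root f)) Q₁ = 0 := by
    have h1 : aeval (algebraMap O L xB * φ (AdjoinRoot.root f')) (scaleRoots Q xB) = 0 :=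
      scaleRoots_aeval_eq_zero hσQ
    rw [hQ₁, aeval_comp]
    simp only [map_sub, aeval_X, aeval_C]
    rw [← hφ]
    exact h1
  have hQ₁M : AdjoinRoot.mk f Q₁ = 0 := by
    rw [aeval_algebraMap_apply, ← map_zero (algebraMap (AdjoinRoot f) L)] at hQ₁t
    rw [← AdjoinRoot.aeval_eq]
    exact hinj hQ₁t
  have hdvd : f ∣ Q₁ := AdjoinRoot.mk_eq_zero.mp hQ₁M
  -- degrees: `deg Q₁ ≤ deg Q < deg f' ≤ deg f`, so `Q₁ = 0`
  have hQ₁deg : Q₁.natDegree < f.natDegree := by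
    rw [hQ₁]
    calc ((scaleRoots Q xB).comp (X - C g)).natDegree
        ≤ (scaleRoots Q xB).natDegree * (X - C g).natDegree := natDegree_comp_le
      _ ≤ (scaleRoots Q xB).natDegree * 1 := Nat.mul_le_mul_left _ (natDegree_X_sub_C_le g)
      _ = Q.natDegree := by rw [mul_one, natDegree_scaleRoots]
      _ < f'.natDegree := hQnat
      _ ≤ f.natDegree := hdeg
  have hQ₁0 : Q₁ = 0 := by
    by_contra h
    exact hfm.not_dvd_of_natDegree_lt h hQ₁deg hdvd
  -- undo the shift: `scaleRoots Q x_B = Q₁(X + g) = 0`, contradicting `Q ≠ 0`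
  have hscale : scaleRoots Q xB = 0 := by
    have h : Q₁.comp (X + C g) = scaleRoots Q xB := by
      rw [hQ₁, comp_assoc]
      simp only [sub_comp, X_comp, C_comp, add_sub_cancel_right, comp_X]
    rw [← h, hQ₁0, zero_comp]
  exact scaleRoots_ne_zero hQ0 xB hscale

/-- **The wound twist embeds.** For a prime `p`, a ring `O`, and an `O`-algebra `L` into which
the model `M = O[t]/(t^p - a)` maps injectively (e.g. `L = Frac M` for `M` a domain, or the
function field of an integral scheme through which `Spec M` factors), every `O`-algebra map
`φ : O[s]/(s^p - u) → L` with `x_B · φ(s) = t - g` is injective: if `Q(φ s) = 0` with `deg Q < p`,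
the rescaled and shifted polynomial `(scaleRoots Q x_B)(X - g)`, of degree `< p`, vanishes at `t`
in `M = O[X]/(X^p - a)`, so is divisible by the monic `X^p - a`, so is zero, whence `Q = 0`.
(Hence, in the first alternative of the Kummer normal form, `M ⊆ O[(t - g)/x_B] ≅ O[s]/(s^p - u)`
inside `Frac M`: the wound twist is an order of `Frac M` containing the model, finite over `O` —
the normalisation of `M` as soon as it is normal, e.g. regular.) [folklore] -/
theorem injective_algHom_adjoinRoot_wound_twist : ∀ {O L : Type*} [CommRing O] [CommRing L] [Algebra O L] (p : ℕ) [Fact p.Prime] (a g u xB : O) [Algebra (AdjoinRoot ((Polynomial.X : Polynomial O) ^ p - Polynomial.C a)) L] [IsScalarTower O (AdjoinRoot ((Polynomial.X : Polynomial O) ^ p - Polynomial.C a)) L], Function.Injective (algebraMap (AdjoinRoot ((Polynomial.X : Polynomial O) ^ p - Polynomial.C a)) L) → ∀ (φ : AdjoinRoot ((Polynomial.X : Polynomial O) ^ p - Polynomial.C u) →ₐ[O] L), algebraMap O L xB * φ (AdjoinRoot.root _) = algebraMap (AdjoinRoot ((Polynomial.X : Polynomial O) ^ p - Polynomial.C a))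 L (AdjoinRoot.root _) - algebraMap O L g → Function.Injective φ := by
  intro O L _ _ _ p _ a g u xB _ _ hinj φ hφ
  rcases subsingleton_or_nontrivial O with hO | hO
  · haveI : Subsingleton (AdjoinRoot ((X : O[X]) ^ p - C u)) := Module.subsingleton O _
    exact Function.injective_of_subsingleton φ
  have hp : p ≠ 0 := (Fact.out : p.Prime).ne_zero
  refine injective_algHom_adjoinRoot_of_monic (monic_X_pow_sub_C a hp) (monic_X_pow_sub_C u hp)
    (le_of_eq ?_) hinj φ xB g hφ
  rw [natDegree_X_pow_sub_C, natDegree_X_pow_sub_C]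

/-- **Compatibility of the two maps.** With `θ : O[t]/(t^p - a) → O[s]/(s^p - u)`,
`t ↦ g + x_B s` (`exists_algHom_adjoinRoot_to_wound_twist`) and `φ : O[s]/(s^p - u) → L`,
`x_B φ(s) = t - g` (`exists_algHom_adjoinRoot_wound_twist_of_isUnit`), the composite `φ ∘ θ` is
the structure map `O[t]/(t^p - a) → L` (both send `t` to `t`); in particular the image of `φ`
contains the image of the model. [folklore] -/
theorem algHom_comp_wound_twist : ∀ {O L : Type*} [CommRing O] [CommRing L] [Algebra O L] (p : ℕ) (a g u xB : O) [Algebra (AdjoinRoot ((Polynomial.X : Polynomial O) ^ p - Polynomial.C a)) L] [IsScalarTower O (AdjoinRoot ((Polynomial.X : Polynomial O) ^ p - Polynomial.C a)) L] (θ : AdjoinRoot ((Polynomial.X : Polynomial O) ^ p - Polynomial.C a) →ₐ[O] AdjoinRoot ((Polynomial.X : Polynomial O) ^ p - Polynomial.C u)) (φ : AdjoinRoot ((Polynomial.X : Polynomial O) ^ p - Polynomial.C u) →ₐ[O] L), θ (AdjoinRoot.root _) = algebraMap O _ g + algebraMap O _ xB * AdjoinRoot.root ((Polynomial.X : Polynomial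 O) ^ p - Polynomial.C u) → algebraMap O L xB * φ (AdjoinRoot.root _) = algebraMap (AdjoinRoot ((Polynomial.X : Polynomial O) ^ p - Polynomial.C a)) L (AdjoinRoot.root _) - algebraMap O L g → φ.comp θ = IsScalarTower.toAlgHom O (AdjoinRoot ((Polynomial.X : Polynomial O) ^ p - Polynomial.C a)) L := by
  intro O L _ _ _ p a g u xB _ _ θ φ hθ hφ
  apply AdjoinRoot.algHom_ext
  rw [AlgHom.comp_apply, hθ, map_add, map_mul, AlgHom.commutes, AlgHom.commutes, hφ,
    IsScalarTower.toAlgHom_apply, add_sub_cancel]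

/-- **The wound twist is an order of the function field of the model.** For a domain `O` of
characteristic `p`, `a = g^p + x_B^p · u` with `x_B ≠ 0`, and the model `M = O[t]/(t^p - a)` a
domain, there is an INJECTIVE `O`-algebra map `O[s]/(s^p - u) → Frac M` with `x_B · s ↦ t - g`,
i.e. `s ↦ t' = (t - g)/x_B` — the twist `t' = (t - g)/∏ x_j^{B_j}`, `t'^p = u`, of the first
alternative of the Kummer normal form; its image contains `M` (`algHom_comp_wound_twist`), so
`O[t'] ≅ O[s]/(s^p - u)` sits between the model and its fraction field, finite over `O`: it is
the normalisation of `M` whenever it is normal (e.g. regular, Stacks 07PG: `D u` a unit).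
[folklore] -/
theorem exists_algHom_adjoinRoot_wound_twist : ∀ {O : Type*} [CommRing O] [IsDomain O] (p : ℕ) [Fact p.Prime] [CharP O p] (a g u xB : O), xB ≠ 0 → a = g ^ p + xB ^ p * u → ∀ [IsDomain (AdjoinRoot ((Polynomial.X : Polynomial O) ^ p - Polynomial.C a))], ∃ φ : AdjoinRoot ((Polynomial.X : Polynomial O) ^ p - Polynomial.C u) →ₐ[O] FractionRing (AdjoinRoot ((Polynomial.X : Polynomial O) ^ p - Polynomial.C a)), Function.Injective φ ∧ algebraMap O _ xB * φ (AdjoinRoot.root _) = algebraMap (AdjoinRoot ((Polynomial.X : Polynomial O) ^ p - Polynomial.C a)) _ (AdjoinRoot.root _) - algebraMap O _ g := by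
  intro O _ _ p _ _ a g u xB hxB ha _
  set f : O[X] := (X : O[X]) ^ p - C a with hf
  have hp : p ≠ 0 := (Fact.out : p.Prime).ne_zero
  have hinjO : Function.Injective (algebraMap O (AdjoinRoot f)) :=
    AdjoinRoot.of.injective_of_degree_ne_zero (by
      rw [hf, degree_X_pow_sub_C (Nat.pos_of_ne_zero hp)]
      exact_mod_cast hp)
  have hunit : IsUnit (algebraMap O (FractionRing (AdjoinRoot f)) xB) := by
    rw [isUnit_iff_ne_zero,
      IsScalarTower.algebraMap_apply O (AdjoinRoot f) (FractionRing (AdjoinRoot f))]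
    intro h0
    apply hxB
    apply hinjO
    apply IsFractionRing.injective (AdjoinRoot f) (FractionRing (AdjoinRoot f))
    rw [h0, map_zero, map_zero]
  have ht : (algebraMap (AdjoinRoot f) (FractionRing (AdjoinRoot f)) (AdjoinRoot.root f)) ^ p =
      algebraMap O (FractionRing (AdjoinRoot f)) a := by
    have h0 : aeval (AdjoinRoot.root f) f = 0 := by rw [AdjoinRoot.aeval_eq, AdjoinRoot.mk_self]
    simp only [hf, map_sub, map_pow, aeval_X, aeval_C] at h0
    rw [← map_pow, sub_eq_zero.mp h0, ← IsScalarTower.algebraMap_apply]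
  obtain ⟨φ, hφ⟩ := exists_algHom_adjoinRoot_wound_twist_of_isUnit p a g u xB _ ha hunit ht
  exact ⟨φ, injective_algHom_adjoinRoot_wound_twist p a g u xB
    (IsFractionRing.injective (AdjoinRoot f) (FractionRing (AdjoinRoot f))) φ hφ, hφ⟩

end Summit.ResolutionOfSingularities.ResolutionOfSingularities.Theorems.PicoverLocalModel.LogRegularEndgame
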